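import Summits.BirchSwinnertonDyer.Rank1Residual.P2.CornerFTwoModelClasses
import Summits.BirchSwinnertonDyer.Rank1Residual.WAll.TargetCMTwoRamifiedOffTYZProved
import HarnessLib

/-!
# Leaf CornerF @ `p = 2` — THE MODEL ATLAS, file 3 (cell `bsd-print-cf2`, D-0131 (2) print tier,
# typer ty2): the residual of the p1 road `WAllCornerFTwoRamifiedOffTYZProved` IN MODEL CURRENCY,
# and the uniqueness of the square-free parameter `n` of a model of `E_n`

HONEST FRAMING (cell `bsd-print-cf2`, HOME `run/shared/lean/pub/bsd-print-cf2/`, verbatim in every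
file): the partition leaf is `CornerF W 2` — `W/ℚ` globally minimal elliptic WITH CM and
`ord_{s=1} L(E,s) = 1`, at the prime `2` (rung leaf `WAllCornerFTwo`; OPEN AS A CLASS). The p1 road
(Tian–Yuan–Zhang induction BY NAME) closes the ramified type on the flag-free TYZ families
`CongruentTYZProvedFamily` (LLT ∨ T5 ∨ T7 ∨ M35 ∨ TYZρ, p535702) and names its residual
`WAllCornerFTwoRamifiedOffTYZProved` (p536500): CM, `r_an = 1`, `2` ramified in `K`, and `W` a
`ℚ`-model of NO member of the families ⇒ `BSD(E,2)`. Files 1–2 of the atlas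
(`CornerFTwoModelAtlas`, `CornerFTwoModelClasses`) reduce the ramified type to four explicit model
families. Here the residual is rewritten through them: it is EQUIVALENT to
(1′) the `E_n` members (`n` square-free) OFF the families — the only conjunct where the family clause
survives, and where print (TYZ / Tian / Smith / Heath-Brown densities) still has something to say —,
∧ (2) ALL quartic twists `y² = x³ + Ax`, `A ∈ ℤ∖{0}`, `−A ∉ ℤ²`, ∧ (3) ALL square-free twists of
`⟨0,−6,0,1,0⟩` (`j = 287496`), ∧ (4) ALL square-free twists of `cm8` (`j = 8000`) — (2)–(4) carry NO
family clause because no such curve is a `ℚ`-model of any `E_m` (`j ≠ 1728`, resp. the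
`ℚ`-isomorphism class of `y² = x³ + Ax` is `A · ℚˣ⁴` and `−A ∉ ℤ²`), and NO theorem in print. Also:
the square-free parameter of a model of `E_n` is unique (`Atlas.smul_congruentNumberCurve_iff_eq`), so
on conjunct (1′) "`W ∉` family" is pure arithmetic on `n` (for p1 to unpack per disjunct).
Fact-free: NO arithmetic fact, NO definition, NO named fact (D-0026).

## Contents

* §0 `Atlas.a₄_eq_of_smul_quartic` (a `ℚ`-isomorphism `C • (y² = x³ + ax) = (y² = x³ + a'x)` has
  `r = s = t = 0` and `a' = u⁻⁴a`; Silverman X.5.4 (ii) / III.1 Table 3.1),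
  `Atlas.isSquare_neg_of_smul_quartic_of_smul_congruentNumberCurve` (a model of `y² = x³ + Ax` that
  is a model of some `E_m` has `−A ∈ ℤ²`),
  `Atlas.eq_of_smul_congruentNumberCurve` / `Atlas.smul_congruentNumberCurve_iff_eq` (square-free
  `n`, `m` with a common `ℚ`-model are equal), `exists_smul_congruentNumberCurve_of_congruentTYZProvedFamily`,
  `not_congruentTYZProvedFamily_of_j_ne`, `not_congruentTYZProvedFamily_of_smul_quartic`.
* §1 `wAllCornerFTwoRamifiedOffTYZProved_iff_models` (the residual ⟺ (1′) ∧ (2) ∧ (3) ∧ (4)).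

References: [SilvermanAEC2009] III.1 Table 3.1, X.5 Prop. 5.4 (ii), X.6 Prop. 6.1 (the quartic twists
`y² = x³ + Dx`, `D ∈ ℚˣ/ℚˣ⁴`); [Tian2014] Thm. 1.3; [TianYuanZhang2017] Thm. 1.2; [LiLiuTian2024]
Thm. 1.2; [Monsky1990MockHeegner] Cor. 5.15; `WAll/TargetCMTwoRamifiedFamilies.lean`,
`WAll/TargetCMTwoRamifiedOffTYZProved.lean` (p1), `P2/CornerFTwoModelAtlas.lean`,
`P2/CornerFTwoModelClasses.lean` (ty2).
-/

noncomputable section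

open scoped Classical

open WeierstrassCurve Literature.NumberTheory.EllipticCurves
  Literature.NumberTheory.EllipticCurves.Rank1Residual
  Literature.NumberTheory.EllipticCurves.HeathBrown1994

set_option autoImplicit false

namespace Summit.BirchSwinnertonDyer.Rank1Residual.P2.CornerFTwo

/-! ## §0 Quartic models up to `ℚ`-isomorphism; uniqueness of the square-free parameter -/

namespace Atlas

variable {W : WeierstrassCurve ℚ}

/-- **A `ℚ`-isomorphism between two quartic models is a pure rescaling**: if
`C • (y² = x³ + ax) = (y² = x³ + a'x)` then `a' = u⁻⁴ a` (`u = C.u`; the coefficients `a₁, a₂, a₃`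
force `s = r = t = 0`). [cite: SilvermanAEC2009, III.1 Table 3.1 and X.5 Prop. 5.4 (ii)] -/
theorem a₄_eq_of_smul_quartic {a a' : ℚ} {C : VariableChange ℚ}
    (h : C • (⟨0, 0, 0, a, 0⟩ : WeierstrassCurve ℚ) = ⟨0, 0, 0, a', 0⟩) :
    a' = ((C.u⁻¹ : ℚˣ) : ℚ) ^ 4 * a := by
  have hu : ((C.u⁻¹ : ℚˣ) : ℚ) ≠ 0 := Units.ne_zero _
  have h₁ := congrArg WeierstrassCurve.a₁ h
  have h₂ := congrArg WeierstrassCurve.a₂ h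
  have h₃ := congrArg WeierstrassCurve.a₃ h
  have h₄ := congrArg WeierstrassCurve.a₄ h
  simp only [WeierstrassCurve.variableChange_a₁, WeierstrassCurve.variableChange_a₂,
    WeierstrassCurve.variableChange_a₃, WeierstrassCurve.variableChange_a₄] at h₁ h₂ h₃ h₄
  have hs : C.s = 0 := by
    have : ((C.u⁻¹ : ℚˣ) : ℚ) * (2 * C.s) = 0 := by linear_combination h₁
    rcases mul_eq_zero.1 this with h0 | h0
    · exact absurd h0 hu
    · linarith
  have hr : C.r = 0 := by
    have : ((C.u⁻¹ : ℚˣ) : ℚ) ^ 2 * (3 * C.r) = 0 := by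
      rw [hs] at h₂; linear_combination h₂
    rcases mul_eq_zero.1 this with h0 | h0
    · exact absurd h0 (pow_ne_zero 2 hu)
    · linarith
  have ht : C.t = 0 := by
    have : ((C.u⁻¹ : ℚˣ) : ℚ) ^ 3 * (2 * C.t) = 0 := by
      rw [hr] at h₃; linear_combination h₃
    rcases mul_eq_zero.1 this with h0 | h0
    · exact absurd h0 (pow_ne_zero 3 hu)
    · linarith
  rw [hs, hr, ht] at h₄
  linear_combination -h₄

/-- **A model of `y² = x³ + Ax` that is also a model of some `E_m` (`m ≠ 0`) has `−A ∈ ℤ²`**: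
`E_m = (y² = x³ − m²x)` and the class of `A` in `ℚˣ/ℚˣ⁴` is an isomorphism invariant, so
`−A = (m u²)²` in `ℚ`, hence in `ℤ`. [cite: SilvermanAEC2009, X.5 Prop. 5.4 (ii) and X.6 Prop. 6.1] -/
theorem isSquare_neg_of_smul_quartic_of_smul_congruentNumberCurve {A : ℤ} {m : ℕ}
    {C C' : VariableChange ℚ} (hC : C • (⟨0, 0, 0, (A : ℚ), 0⟩ : WeierstrassCurve ℚ) = W)
    (hC' : C' • congruentNumberCurve m = W) : IsSquare (-A) := by
  have h : (C'⁻¹ * C) • (⟨0, 0, 0, (A : ℚ), 0⟩ : WeierstrassCurve ℚ) =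
      ⟨0, 0, 0, -((m : ℚ) ^ 2), 0⟩ := by
    rw [mul_smul, hC, ← hC', inv_smul_smul]; rfl
  have key := a₄_eq_of_smul_quartic h
  set v : ℚ := (((C'⁻¹ * C).u⁻¹ : ℚˣ) : ℚ) with hv
  have hv0 : v ≠ 0 := Units.ne_zero _
  -- `−A = (m / v²)²`
  have hsq : IsSquare (((-A : ℤ)) : ℚ) := by
    refine ⟨(m : ℚ) / v ^ 2, ?_⟩
    have : (A : ℚ) = -((m : ℚ) ^ 2) / v ^ 4 := by
      field_simp
      linear_combination -key
    push_cast
    rw [this]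
    field_simp
  exact Rat.isSquare_intCast_iff.1 hsq

/-- **The square-free parameter of a model of `E_n` is unique**: if `W` is a `ℚ`-model of `E_n` and
of `E_m`, `n`, `m` square-free, then `n = m` (`−m² = u⁻⁴(−n²)` gives `m = v²n`, so `mn ∈ ℕ²`).
[cite: SilvermanAEC2009, X.5 Prop. 5.4 (ii) and X.6 Prop. 6.1] -/
theorem eq_of_smul_congruentNumberCurve {n m : ℕ} (hn : Squarefree n) (hm : Squarefree m)
    {C C' : VariableChange ℚ} (hC : C • congruentNumberCurve n = W)
    (hC' : C' • congruentNumberCurve m = W) : n = m := by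
  have h : (C'⁻¹ * C) • (⟨0, 0, 0, -((n : ℚ) ^ 2), 0⟩ : WeierstrassCurve ℚ) =
      ⟨0, 0, 0, -((m : ℚ) ^ 2), 0⟩ := by
    have e : (⟨0, 0, 0, -((n : ℚ) ^ 2), 0⟩ : WeierstrassCurve ℚ) = congruentNumberCurve n := rfl
    rw [e, mul_smul, hC, ← hC', inv_smul_smul]; rfl
  have key := a₄_eq_of_smul_quartic h
  set v : ℚ := (((C'⁻¹ * C).u⁻¹ : ℚˣ) : ℚ) with hv
  -- `m² = (v² n)²` with `m, v² n ≥ 0` ⇒ `m = v² n`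
  have hmv : (m : ℚ) = v ^ 2 * n := by
    have h2 : ((m : ℚ)) ^ 2 = (v ^ 2 * n) ^ 2 := by linear_combination -key
    have hm0 : (0 : ℚ) ≤ m := by positivity
    have hvn : (0 : ℚ) ≤ v ^ 2 * n := by positivity
    nlinarith [sq_nonneg ((m : ℚ) - v ^ 2 * n), sq_nonneg ((m : ℚ) + v ^ 2 * n)]
  have hsq : IsSquare (((m * n : ℕ)) : ℚ) := ⟨v * n, by push_cast; rw [hmv]; ring⟩
  -- square-free `m`, `n` with `m n` a square are equal (the tree's
  -- `Literature.NumberTheory.Sieve.FriedlanderIwaniecPrimes.eq_of_squarefree_of_isSquare_mul`, whose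
  -- sieve module is not imported into this corner; the five-line factorization argument is inlined)
  obtain ⟨r, hr⟩ := Rat.isSquare_natCast_iff.1 hsq
  have hm0 := hm.ne_zero
  have hn0 := hn.ne_zero
  have hr0 : r ≠ 0 := by
    rintro rfl
    exact (Nat.mul_ne_zero hm0 hn0) (by simpa using hr)
  refine (Nat.eq_of_factorization_eq hm0 hn0 (fun p => ?_)).symm
  have h1 := congrArg (fun x => x.factorization p) hr
  simp only [Nat.factorization_mul hm0 hn0, Nat.factorization_mul hr0 hr0, Finsupp.add_apply] at h1
  have hmp := hm.natFactorization_le_one p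
  have hnp := hn.natFactorization_le_one p
  omega

/-- For `W` a model of `E_n` (`n` square-free): `W` is a model of `E_m` (`m` square-free) iff `m = n`.
So on such `W` membership in any `E`-family predicate is arithmetic on `n`. [folklore] -/
theorem smul_congruentNumberCurve_iff_eq {n m : ℕ} (hn : Squarefree n) (hm : Squarefree m)
    (hW : ∃ C : VariableChange ℚ, C • congruentNumberCurve n = W) :
    (∃ C : VariableChange ℚ, C • congruentNumberCurve m = W) ↔ m = n := by
  obtain ⟨C, hC⟩ := hW
  refine ⟨fun ⟨C', hC'⟩ => (eq_of_smul_congruentNumberCurve hn hm hC hC').symm, ?_⟩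
  rintro rfl
  exact ⟨C, hC⟩

end Atlas

open Atlas

/-! ### Membership in the TYZ families forces a model of some `E_m` -/

section Families

variable {W : WeierstrassCurve ℚ} [W.IsElliptic] [W.IsGloballyMinimal]

/-- Every member of p1's `CongruentTYZProvedFamily` is a `ℚ`-model of some `E_m`, `m` square-free
(read off the five disjuncts). [folklore] -/
theorem exists_smul_congruentNumberCurve_of_congruentTYZProvedFamily (h : CongruentTYZProvedFamily W) :
    ∃ m : ℕ, Squarefree m ∧ ∃ C : VariableChange ℚ, C • congruentNumberCurve m = W := by
  rcases h with ⟨n, hsq, -, -, -, C, hC⟩ | ⟨k, p, hp, hinj, -, -, -, C, hC⟩ |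
      ⟨k, p, hp, hinj, -, -, -, C, hC⟩ | ⟨p, q, hp, hq, hp8, hq8, C, hC⟩ | ⟨n, hsq, -, -, -, -, C, hC⟩
  · exact ⟨n, hsq, C, hC⟩
  · exact ⟨_, squarefree_prod_of_injective p hp hinj, C, hC⟩
  · exact ⟨_, squarefree_prod_of_injective p hp hinj, C, hC⟩
  · refine ⟨p * q, ?_, C, hC⟩
    have hpq : p ≠ q := by rintro rfl; omega
    rw [Nat.squarefree_mul_iff]
    exact ⟨(Nat.coprime_primes hp hq).2 hpq, hp.squarefree, hq.squarefree⟩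
  · exact ⟨n, hsq, C, hC⟩

omit [W.IsGloballyMinimal] in
/-- A model of `E_m` (`m ≠ 0`) has `j = 1728`. [folklore] -/
theorem j_eq_1728_of_smul_congruentNumberCurve {m : ℕ} (hm : m ≠ 0) {C : VariableChange ℚ}
    (hC : C • congruentNumberCurve m = W) : W.j = 1728 := by
  haveI := isElliptic_congruentNumberCurve hm
  rw [j_eq_of_smul_eq hC, congruentNumberCurve_j]

/-- **Curves with `j ≠ 1728` are in no TYZ family** (the families are models of `E_m`). [folklore] -/
theorem not_congruentTYZProvedFamily_of_j_ne (hj : W.j ≠ 1728) : ¬ CongruentTYZProvedFamily W := by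
  intro h
  obtain ⟨m, hm, C, hC⟩ := exists_smul_congruentNumberCurve_of_congruentTYZProvedFamily h
  exact hj (j_eq_1728_of_smul_congruentNumberCurve hm.ne_zero hC)

/-- **The quartic twists with `−A ∉ ℤ²` are in no TYZ family.** [cite: SilvermanAEC2009, X.5 Prop. 5.4 (ii)] -/
theorem not_congruentTYZProvedFamily_of_smul_quartic {A : ℤ} (hA : ¬ IsSquare (-A))
    {C : VariableChange ℚ} (hC : C • (⟨0, 0, 0, (A : ℚ), 0⟩ : WeierstrassCurve ℚ) = W) :
    ¬ CongruentTYZProvedFamily W := by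
  intro h
  obtain ⟨m, -, C', hC'⟩ := exists_smul_congruentNumberCurve_of_congruentTYZProvedFamily h
  exact hA (isSquare_neg_of_smul_quartic_of_smul_congruentNumberCurve hC hC')

end Families

/-! ## §1 The residual of the p1 road in model currency -/

/-- **`WAllCornerFTwoRamifiedOffTYZProved` IN MODEL CURRENCY.** The residual of the flag-free p1 road
(p536500) is EQUIVALENT to the conjunction of:
(1′) `BSD(W,2)` for every globally minimal model `W` of a congruent-number curve `E_n`, `n` square-free,
which is in NO TYZ family (`¬ CongruentTYZProvedFamily W`; by `Atlas.smul_congruentNumberCurve_iff_eq`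
this is arithmetic on `n`) and has analytic rank one;
(2) `BSD(W,2)` for every globally minimal model `W` of `y² = x³ + Ax`, `A ∈ ℤ∖{0}`, `−A ∉ ℤ²`, of
analytic rank one — no family clause (`not_congruentTYZProvedFamily_of_smul_quartic`), no print;
(3) the same for the square-free twists of `⟨0,−6,0,1,0⟩` (`j = 287496`) — no family clause, no print;
(4) the same for the square-free twists of `cm8` (`j = 8000`) — no family clause, no print.
Fact-free. [cite: SilvermanAEC2009, X.5 Prop. 5.4 and Cor. 5.4.1] [cite: Miller2011LMS, Def. 1.1 (arXiv:1010.2431 p. 3)] -/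
theorem wAllCornerFTwoRamifiedOffTYZProved_iff_models :
    WAllCornerFTwoRamifiedOffTYZProved ↔
      (∀ n : ℕ, Squarefree n →
        ∀ (W : WeierstrassCurve ℚ) [W.IsElliptic] [W.IsGloballyMinimal],
          (∃ C : VariableChange ℚ, C • congruentNumberCurve n = W) →
          ¬ CongruentTYZProvedFamily W → W.analyticRank = 1 → BSDp W 2) ∧
      (∀ A : ℤ, A ≠ 0 → ¬ IsSquare (-A) →
        ∀ (W : WeierstrassCurve ℚ) [W.IsElliptic] [W.IsGloballyMinimal],
          (∃ C : VariableChange ℚ, C • (⟨0, 0, 0, (A : ℚ), 0⟩ : WeierstrassCurve ℚ) = W) →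
          W.analyticRank = 1 → BSDp W 2) ∧
      (∀ d : ℤ, d ≠ 0 → Squarefree d →
        ∀ (W : WeierstrassCurve ℚ) [W.IsElliptic] [W.IsGloballyMinimal],
          (∃ C : VariableChange ℚ,
            C • (⟨0, -6, 0, 1, 0⟩ : WeierstrassCurve ℚ).quadraticTwist (d : ℚ) = W) →
          W.analyticRank = 1 → BSDp W 2) ∧
      (∀ d : ℤ, d ≠ 0 → Squarefree d →
        ∀ (W : WeierstrassCurve ℚ) [W.IsElliptic] [W.IsGloballyMinimal],
          (∃ C : VariableChange ℚ, C • cm8.quadraticTwist (d : ℚ) = W) →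
          W.analyticRank = 1 → BSDp W 2) := by
  constructor
  · intro h
    refine ⟨?_, ?_, ?_, ?_⟩
    · intro n hn W _ _ hW hF hr
      obtain ⟨C, hC⟩ := hW
      obtain ⟨hcm, hram⟩ :=
        hasCM_and_cmRamified_two_of_smul_congruentNumberCurve hn.ne_zero hC
      exact h W hcm hr hram hF
    · intro A hA hsq W _ _ hW hr
      obtain ⟨C, hC⟩ := hW
      have hA' : (A : ℚ) ≠ 0 := by exact_mod_cast hA
      obtain ⟨hcm, hram⟩ := hasCM_and_cmRamified_two_of_smul_quartic hA' hC
      exact h W hcm hr hram (not_congruentTYZProvedFamily_of_smul_quartic hsq hC)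
    · intro d hd _ W _ _ hW hr
      obtain ⟨C, hC⟩ := hW
      have hd' : (d : ℚ) ≠ 0 := by exact_mod_cast hd
      have hj : W.j = 287496 := by rw [j_eq_of_smul_twist hd' hC, j_cm16]
      obtain ⟨hcm, hram⟩ := hasCM_and_cmRamified_two_of_j (W := W) (Or.inl hj)
      exact h W hcm hr hram (not_congruentTYZProvedFamily_of_j_ne (by rw [hj]; norm_num))
    · intro d hd _ W _ _ hW hr
      obtain ⟨C, hC⟩ := hW
      have hd' : (d : ℚ) ≠ 0 := by exact_mod_cast hd
      have hj : W.j = 8000 := by rw [j_eq_of_smul_twist hd' hC, j_cm8]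
      obtain ⟨hcm, hram⟩ := hasCM_and_cmRamified_two_of_j (W := W) (Or.inr hj)
      exact h W hcm hr hram (not_congruentTYZProvedFamily_of_j_ne (by rw [hj]; norm_num))
  · rintro ⟨h₁, h₂, h₃, h₄⟩ W _ _ hcm hr hram hF
    rcases ramifiedAtlas hcm hram with ⟨n, hn, hW⟩ | ⟨A, hA, hsq, hW⟩ | ⟨d, hd, hsqf, hW⟩ |
        ⟨d, hd, hsqf, hW⟩
    · exact h₁ n hn W hW hF hr
    · exact h₂ A hA hsq W hW hr
    · exact h₃ d hd hsqf W hW hr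
    · exact h₄ d hd hsqf W hW hr

end Summit.BirchSwinnertonDyer.Rank1Residual.P2.CornerFTwo

end
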